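import Summits.BirchSwinnertonDyer.BirchSwinnertonDyer.Theses.TwoAdicConverse
import Summits.BirchSwinnertonDyer.BirchSwinnertonDyer.Theorems.TwoAdicConverseGoodOrdinaryPub

/-!
# Glue of the layer-2 split of `GoodOrdinaryRankZeroTwoConverse` (route TwoAdicConverse, rung S3)

The glued split (D-0019) of the crux `GoodOrdinaryRankZeroTwoConverse` into
`OrdConversePublishedInputsAtTwo` (support: modularity ∧ Kato 17.4 (1)(2) at 2 ∧ Greenberg Thm 4.1
parity-free) and `OrdEisensteinHalfAtTwo` (crux: the Eisenstein half of the 2-adic cyclotomic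
main conjecture, rank-free, shared with route ByReductionTypeAtTwo) is closed by ONE application of
the landed bridge `Theorems.goodOrdinaryRankZeroTwoConverse_of_facts_of_eisenstein` (p409493, seat
bsd-2adic-ord GEN 3). Nothing is asserted: both children stay open items of the route.
-/

namespace Summit.BirchSwinnertonDyer.BirchSwinnertonDyer.Theorems

/-- The split glue `OrdConversePublishedInputsAtTwo → OrdEisensteinHalfAtTwo →
GoodOrdinaryRankZeroTwoConverse` of route TwoAdicConverse, proved from the PUB bridge
`goodOrdinaryRankZeroTwoConverse_of_facts_of_eisenstein`. -/
theorem goodOrdinaryRankZeroTwoConverseOfChildren_proof :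
    Summit.BirchSwinnertonDyer.BirchSwinnertonDyer.Theses.TwoAdicConverse.GoodOrdinaryRankZeroTwoConverseOfChildren := by
  intro hP hE
  obtain ⟨hmod, h17, hGr⟩ := hP
  exact goodOrdinaryRankZeroTwoConverse_of_facts_of_eisenstein hmod h17 hGr (fun W _ _ hcm hgo => hE W hcm hgo)

end Summit.BirchSwinnertonDyer.BirchSwinnertonDyer.Theorems
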